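import Summits.ABC.ABC.Theorems.DepthCountedABC.Negative.LoadBearing
import Literature.Barriers.ABC.EpsilonCannotBeDroppedProofs

/-!
# `DepthCountedABC` (stmt-ABC-14938): the `ε = 0` boundary on the depth cells

Negative-side support lemmas for the crux `Summit.ABC.ABC.Theses.IneffectiveSubspace.DepthCountedABC`
(abc with `C = C(K, ε)` on each cell `ω₅(abc) := #{p : p⁵ ∣ abc} ≤ K`), from the crux disprover's
cycle-1 attack (`Cruxes/DepthCountedABC/Disproof.lean`, sections D–E).

* `depthCountedABC_not_uniform_constant` — one constant serving every `(K, ε)` is false (reduces to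
  `Literature.Barriers.ABC.not_abc_uniform_constant`, Granville–Tucker).
* WHY THE `ε = 0` VERSION IS NOT REFUTED CELL-WISE.  The cell condition is an UPPER bound on `ω₅`, so a
  witness family with `c/rad → ∞` needs certified bounded depth of every cofactor; the printed `ε = 0`
  families (`2^{p(p−1)}`, `3^{2^k}`, Stewart–Tijdeman) have uncontrolled `ω₅` — in contrast with the
  deep-tail crux, where a LOWER bound on `ω₅` tolerates junk
  (`Summit.ABC.ABC.Theorems.DeepRegimeABC.Negative.deepRegimeABC_false_without_eps`).  Sharp form
  for the Bombieri–Gubler family `T_k = (1, 3^(2^k) − 1, 3^(2^k))`: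
  - `prime_pow_dvd_pow_sub_one_of_coprime` — the order argument: `q ∤ x`, `gcd(n, q) = 1`,
    `q^j ∣ xⁿ − 1` ⟹ `q^j ∣ x^(q−1) − 1`;
  - `wieferich_of_deep_prime_Tk` — an odd prime `q ≠ 3` that is 5-deep in `T_k` satisfies
    `q⁵ ∣ 3^(q−1) − 1` (a depth-5 base-3 Wieferich prime; none is known);
  - `depthCountedABC_epsZero_imp_wieferich_infinite` — "on every cell one constant gives
    `c ≤ C·rad(abc)`" forces `{q prime : q⁵ ∣ 3^(q−1) − 1}` to be INFINITE; contrapositive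
    `depthCountedABC_not_epsZero_of_wieferich_finite`; and cell-wise
    `depthCountedABC_epsZero_cell_imp_Tk_escapes`: an `ε`-free constant on ONE cell `K` pushes
    `ω₅(T_k)` above `K` for every `k` with `2^k > 6C`.
  So a proof that `ε` cannot be dropped on a FIXED cell must exhibit infinitely many such primes or
  a new bounded-depth family; and no proof of the crux can set `ε = 0` cell-wise without proving
  that set infinite.
* The same for EVERY odd base `x ≥ 3` is the companion file `EpsZeroWieferichBase.lean`.
-/

-- `Summit.<Summit>.<Problem>` is the mandated summit-side namespace (CONVENTIONS §2); for the
-- single-conjunct summit `ABC` the two coincide, so the duplicate `ABC.ABC` is deliberate.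
set_option linter.dupNamespace false

namespace Summit.ABC.ABC.Theorems.DepthCountedABC.Negative

open Literature.NumberTheory.DiophantineGeometry UniqueFactorizationMonoid

/-- **One constant for every `(K, ε)` is false.**  `∃ C ∀ K ∀ ε > 0 …` would give one `C` serving
every `ε > 0` on ALL abc triples (`K := ω₅(abc)`), i.e. `c ≤ C·rad(abc)` in the limit `ε → 0⁺`, which
Granville–Tucker's example kills (`Literature.Barriers.ABC.not_abc_uniform_constant`).  So `C(K, ε)`
is unbounded as `ε → 0⁺` along some sequence of cells. [cite: GranvilleTucker2002, p. 1227] -/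
theorem depthCountedABC_not_uniform_constant :
    ¬ ∃ C : ℝ, ∀ K : ℕ, ∀ ε : ℝ, 0 < ε → ∀ a b c : ℕ, IsABCTriple a b c →
      ((a * b * c).primeFactors.filter (fun p => 5 ≤ (a * b * c).factorization p)).card ≤ K →
      (c : ℝ) < C * ((rad a b c : ℕ) : ℝ) ^ (1 + ε) := by
  rintro ⟨C, hC⟩
  exact Literature.Barriers.ABC.not_abc_uniform_constant
    ⟨C, fun ε hε a b c ht => hC _ ε hε a b c ht le_rfl⟩

/-- **Order argument.** If `q` is prime, `q ∤ x`, the exponent `n` is coprime to `q`, and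
`q^j ∣ xⁿ − 1`, then `q^j ∣ x^(q−1) − 1`: the order of `x` in `(ℤ/q^j)ˣ` divides both `n` and
`q^(j−1)(q − 1)`, hence `q − 1`. [folklore] -/
theorem prime_pow_dvd_pow_sub_one_of_coprime {q x n j : ℕ} (hq : q.Prime) (hqx : ¬ q ∣ x)
    (hn : Nat.Coprime n q) (h : q ^ j ∣ x ^ n - 1) : q ^ j ∣ x ^ (q - 1) - 1 := by
  rcases Nat.eq_zero_or_pos j with rfl | hj
  · simp
  have hx0 : 0 < x := Nat.pos_of_ne_zero (fun h0 => hqx (h0 ▸ dvd_zero q))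
  have hx1 : 1 ≤ x ^ n := Nat.one_le_pow _ _ hx0
  have hx1' : 1 ≤ x ^ (q - 1) := Nat.one_le_pow _ _ hx0
  have hcop : Nat.Coprime x (q ^ j) :=
    Nat.Coprime.pow_right j ((Nat.Prime.coprime_iff_not_dvd hq).mpr hqx).symm
  set u : (ZMod (q ^ j))ˣ := ZMod.unitOfCoprime x hcop with hu
  have hun : u ^ n = 1 := by
    have hz : ((x ^ n - 1 : ℕ) : ZMod (q ^ j)) = 0 := (ZMod.natCast_eq_zero_iff _ _).mpr h
    rw [Nat.cast_sub hx1, Nat.cast_pow, Nat.cast_one, sub_eq_zero] at hz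
    ext
    rw [Units.val_pow_eq_pow_val, hu, ZMod.coe_unitOfCoprime, Units.val_one]
    exact hz
  have hord_n : orderOf u ∣ n := orderOf_dvd_of_pow_eq_one hun
  have hord_tot : orderOf u ∣ q ^ (j - 1) * (q - 1) := by
    have := ZMod.pow_totient u
    rw [Nat.totient_prime_pow hq hj] at this
    exact orderOf_dvd_of_pow_eq_one this
  have hcop2 : Nat.Coprime (orderOf u) (q ^ (j - 1)) :=
    Nat.Coprime.pow_right _ (Nat.Coprime.coprime_dvd_left hord_n hn)
  have hord : orderOf u ∣ q - 1 := hcop2.dvd_of_dvd_mul_left hord_tot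
  have hu1 : u ^ (q - 1) = 1 := orderOf_dvd_iff_pow_eq_one.mp hord
  have hz : ((x : ZMod (q ^ j))) ^ (q - 1) = 1 := by
    have := congrArg Units.val hu1
    rwa [Units.val_pow_eq_pow_val, hu, ZMod.coe_unitOfCoprime, Units.val_one] at this
  have : ((x ^ (q - 1) - 1 : ℕ) : ZMod (q ^ j)) = 0 := by
    rw [Nat.cast_sub hx1', Nat.cast_pow, Nat.cast_one, hz, sub_self]
  exact (ZMod.natCast_eq_zero_iff _ _).mp this

/-- **Deep primes of `T_k = (1, 3^(2^k) − 1, 3^(2^k))` are depth-5 base-3 Wieferich primes.**  An odd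
prime `q ≠ 3` dividing `abc = (3^(2^k) − 1)·3^(2^k)` to the fifth power satisfies `q⁵ ∣ 3^(q−1) − 1`.
[folklore] -/
theorem wieferich_of_deep_prime_Tk {q k : ℕ} (hq : q.Prime) (hq2 : q ≠ 2) (hq3 : q ≠ 3)
    (h : q ^ 5 ∣ 1 * (3 ^ (2 ^ k) - 1) * 3 ^ (2 ^ k)) : q ^ 5 ∣ 3 ^ (q - 1) - 1 := by
  have hcop : Nat.Coprime (q ^ 5) (3 ^ (2 ^ k)) :=
    Nat.Coprime.pow _ _ ((Nat.coprime_primes hq Nat.prime_three).mpr hq3)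
  have h5b : q ^ 5 ∣ 3 ^ (2 ^ k) - 1 := hcop.dvd_of_dvd_mul_right (by simpa [one_mul] using h)
  refine prime_pow_dvd_pow_sub_one_of_coprime hq ?_ ?_ h5b
  · intro h3
    exact hq3 ((Nat.prime_dvd_prime_iff_eq hq Nat.prime_three).mp h3)
  · exact Nat.Coprime.pow_left _ ((Nat.coprime_primes Nat.prime_two hq).mpr (Ne.symm hq2))

/-- `2^(k+3) ∣ 3^(2^(k+1)) − 1` in `ℤ`: `3² − 1 = 8` and `x² − 1 = (x − 1)(x + 1)`, `x + 1` even.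
[folklore] -/
theorem two_pow_dvd_three_pow_sub_one_int (k : ℕ) :
    (2 : ℤ) ^ (k + 3) ∣ (3 : ℤ) ^ (2 ^ (k + 1)) - 1 := by
  induction k with
  | zero => norm_num
  | succ k ih =>
    have hsq : (3 : ℤ) ^ (2 ^ (k + 1 + 1)) - 1 =
        ((3 : ℤ) ^ (2 ^ (k + 1)) - 1) * ((3 : ℤ) ^ (2 ^ (k + 1)) + 1) := by
      rw [pow_succ 2 (k + 1), pow_mul]; ring
    have h2 : (2 : ℤ) ∣ (3 : ℤ) ^ (2 ^ (k + 1)) + 1 := by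
      have h3 : Odd ((3 : ℤ) ^ (2 ^ (k + 1))) := Odd.pow ⟨1, by norm_num⟩
      obtain ⟨m, hm⟩ := h3
      exact ⟨m + 1, by rw [hm]; ring⟩
    rw [hsq, pow_succ]
    exact mul_dvd_mul ih h2

/-- `2^(k+3) ∣ 3^(2^(k+1)) − 1` in `ℕ` (`v₂(3^(2^(k+1)) − 1) = k + 3`). [folklore] -/
theorem two_pow_dvd_three_pow_sub_one (k : ℕ) : 2 ^ (k + 3) ∣ 3 ^ (2 ^ (k + 1)) - 1 := by
  have h := two_pow_dvd_three_pow_sub_one_int k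
  have h1 : 1 ≤ 3 ^ (2 ^ (k + 1)) := Nat.one_le_pow _ _ (by norm_num)
  rw [← Int.natCast_dvd_natCast]
  push_cast [Nat.cast_sub h1]
  exact h

/-- Radical bound along `T_k`: if `b = 2^(k+3)·t > 0` then `rad(1 · b · 3^e)·2^(k+3) ≤ 6·b`
(`rad ∣ 6t`). [folklore] -/
theorem rad_Tk_mul_two_pow_le {b t e k : ℕ} (ht : b = 2 ^ (k + 3) * t) (hb : 0 < b) :
    rad 1 b (3 ^ e) * 2 ^ (k + 3) ≤ 6 * b := by
  have ht0 : 0 < t := by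
    rcases Nat.eq_zero_or_pos t with h0 | h0
    · simp [ht, h0] at hb
    · exact h0
  have hk6 : 6 * t ≠ 0 := by omega
  have hdvd : radical (1 * b * 3 ^ e) ∣ 6 * t := by
    rw [Nat.radical_dvd_iff hk6]
    intro q hq
    rw [Nat.mem_primeFactors] at hq ⊢
    obtain ⟨hqprime, hqdvd, -⟩ := hq
    refine ⟨hqprime, ?_, hk6⟩
    rw [one_mul] at hqdvd
    rcases (Nat.Prime.dvd_mul hqprime).mp hqdvd with h | h
    · rw [ht] at h
      rcases (Nat.Prime.dvd_mul hqprime).mp h with h1 | h1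
      · have := (Nat.prime_dvd_prime_iff_eq hqprime Nat.prime_two).mp (hqprime.dvd_of_dvd_pow h1)
        subst this
        exact dvd_mul_of_dvd_left (by norm_num) _
      · exact dvd_mul_of_dvd_right h1 _
    · have := (Nat.prime_dvd_prime_iff_eq hqprime Nat.prime_three).mp (hqprime.dvd_of_dvd_pow h)
      subst this
      exact dvd_mul_of_dvd_left (by norm_num) _
  have hle : radical (1 * b * 3 ^ e) ≤ 6 * t := Nat.le_of_dvd (by omega) hdvd
  calc rad 1 b (3 ^ e) * 2 ^ (k + 3) = radical (1 * b * 3 ^ e) * 2 ^ (k + 3) := rfl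
    _ ≤ 6 * t * 2 ^ (k + 3) := Nat.mul_le_mul_right _ hle
    _ = 6 * b := by rw [ht]; ring

/-- **An `ε`-free constant on ONE cell pushes `T_k` out of that cell.**  If `c ≤ C·rad(abc)` for every
abc triple of the cell `ω₅(abc) ≤ K`, then `ω₅(T_k) > K` for every `k` with `2^k > 6C`, where
`T_k = (1, 3^(2^(k+1)) − 1, 3^(2^(k+1)))` (`rad(T_k) ≤ 6b/2^(k+3) < c/C`).  This is the concrete
prediction — `ω₅(3^(2^(k+1)) − 1) → ∞` — that any `ε`-free cell statement entails. [folklore] -/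
theorem depthCountedABC_epsZero_cell_imp_Tk_escapes {K : ℕ} {C : ℝ}
    (hC : ∀ a b c : ℕ, IsABCTriple a b c →
      ((a * b * c).primeFactors.filter (fun p => 5 ≤ (a * b * c).factorization p)).card ≤ K →
      (c : ℝ) ≤ C * ((rad a b c : ℕ) : ℝ))
    {k : ℕ} (hk : 6 * C < 2 ^ k) :
    K < ((1 * (3 ^ (2 ^ (k + 1)) - 1) * 3 ^ (2 ^ (k + 1))).primeFactors.filter
      (fun p => 5 ≤ (1 * (3 ^ (2 ^ (k + 1)) - 1) * 3 ^ (2 ^ (k + 1))).factorization p)).card := by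
  by_contra hle'
  push Not at hle'
  set e := 2 ^ (k + 1) with he
  have he0 : e ≠ 0 := by positivity
  have h3e : 2 ≤ 3 ^ e := by
    calc 2 ≤ 3 ^ 1 := by norm_num
      _ ≤ 3 ^ e := Nat.pow_le_pow_right (by norm_num) (Nat.one_le_iff_ne_zero.mpr he0)
  set b := 3 ^ e - 1 with hb
  have hb_pos : 0 < b := by omega
  have hb_lt : b < 3 ^ e := by omega
  have habc : IsABCTriple 1 b (3 ^ e) := ⟨one_pos, hb_pos, by omega, Nat.coprime_one_left _⟩
  have hle := hC 1 b (3 ^ e) habc hle'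
  obtain ⟨t, ht⟩ := two_pow_dvd_three_pow_sub_one k
  have key : rad 1 b (3 ^ e) * 2 ^ (k + 3) ≤ 6 * b := rad_Tk_mul_two_pow_le ht hb_pos
  have keyR : (rad 1 b (3 ^ e) : ℝ) * 2 ^ (k + 3) ≤ 6 * b := by exact_mod_cast key
  have hbR : (0 : ℝ) < b := by exact_mod_cast hb_pos
  have hbltR : (b : ℝ) < ((3 ^ e : ℕ) : ℝ) := by exact_mod_cast hb_lt
  have h2k : (0 : ℝ) < 2 ^ (k + 3) := by positivity
  rcases le_or_gt C 0 with hC0 | hC0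
  · have : C * (rad 1 b (3 ^ e) : ℝ) ≤ 0 := mul_nonpos_of_nonpos_of_nonneg hC0 (Nat.cast_nonneg _)
    linarith
  · have hrad : (rad 1 b (3 ^ e) : ℝ) ≤ 6 * b / 2 ^ (k + 3) := by
      rw [le_div_iff₀ h2k]; exact keyR
    have hratio : 6 * C / 2 ^ (k + 3) < 1 := by
      rw [div_lt_one h2k]
      calc 6 * C < 2 ^ k := hk
        _ ≤ 2 ^ (k + 3) := pow_le_pow_right₀ (by norm_num) (by omega)
    have : C * (rad 1 b (3 ^ e) : ℝ) < ((3 ^ e : ℕ) : ℝ) :=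
      calc C * (rad 1 b (3 ^ e) : ℝ) ≤ C * (6 * b / 2 ^ (k + 3)) := by gcongr
        _ = (6 * C / 2 ^ (k + 3)) * b := by ring
        _ < 1 * b := by gcongr
        _ = b := one_mul _
        _ < ((3 ^ e : ℕ) : ℝ) := hbltR
    linarith

/-- **`ε = 0` on the depth cells forces infinitely many depth-5 base-3 Wieferich primes.**  If for
every `K` one constant `C(K)` gave `c ≤ C·rad(abc)` on the cell `ω₅(abc) ≤ K` (the crux with exponent
`1` in place of `1 + ε`, weak `≤` form, `C` of either sign), then `{q prime : q⁵ ∣ 3^(q−1) − 1}` is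
infinite: otherwise, with `W` that finite set, the cell `K = #W + 2` contains every `T_k` (its deep
primes lie in `{2, 3} ∪ W` by `wieferich_of_deep_prime_Tk`), contradicting
`depthCountedABC_epsZero_cell_imp_Tk_escapes`.  No such prime is known (the known base-3 Wieferich primes
are `11` and `1006003` — the only ones below `5·10⁶` by direct check — both with `q² ‖ 3^(q−1) − 1`), and heuristically there are
finitely many — so the `ε = 0` cell statement is as false as that is true, but not refuted. [folklore] -/
theorem depthCountedABC_epsZero_imp_wieferich_infinite
    (h : ∀ K : ℕ, ∃ C : ℝ, ∀ a b c : ℕ, IsABCTriple a b c →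
      ((a * b * c).primeFactors.filter (fun p => 5 ≤ (a * b * c).factorization p)).card ≤ K →
      (c : ℝ) ≤ C * ((rad a b c : ℕ) : ℝ)) :
    {q : ℕ | q.Prime ∧ q ^ 5 ∣ 3 ^ (q - 1) - 1}.Infinite := by
  intro hfin
  set W := hfin.toFinset with hW
  obtain ⟨C, hC⟩ := h (W.card + 2)
  obtain ⟨k, hk⟩ := pow_unbounded_of_one_lt (6 * C) (by norm_num : (1 : ℝ) < 2)
  have hesc := depthCountedABC_epsZero_cell_imp_Tk_escapes hC hk
  -- but the deep primes of `T_k` lie in `{2, 3} ∪ W`, a set of size ≤ #W + 2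
  set e := 2 ^ (k + 1) with he
  have he0 : e ≠ 0 := by positivity
  have h3e : 2 ≤ 3 ^ e := by
    calc 2 ≤ 3 ^ 1 := by norm_num
      _ ≤ 3 ^ e := Nat.pow_le_pow_right (by norm_num) (Nat.one_le_iff_ne_zero.mpr he0)
  have hne : 1 * (3 ^ e - 1) * 3 ^ e ≠ 0 := by
    have : 0 < 3 ^ e - 1 := by omega
    positivity
  have hcell : ((1 * (3 ^ e - 1) * 3 ^ e).primeFactors.filter
      (fun p => 5 ≤ (1 * (3 ^ e - 1) * 3 ^ e).factorization p)).card ≤ W.card + 2 := by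
    refine le_trans (card_deep_le_card hne (insert 2 (insert 3 W)) ?_) ?_
    · intro q hq h5
      by_cases hq2 : q = 2
      · simp [hq2]
      by_cases hq3 : q = 3
      · simp [hq3]
      have hqW : q ∈ {q : ℕ | q.Prime ∧ q ^ 5 ∣ 3 ^ (q - 1) - 1} :=
        ⟨hq, wieferich_of_deep_prime_Tk hq hq2 hq3 (by simpa [he] using h5)⟩
      have : q ∈ W := by rw [hW, Set.Finite.mem_toFinset]; exact hqW
      simp [this]
    · calc (insert 2 (insert 3 W)).card ≤ (insert 3 W).card + 1 := Finset.card_insert_le _ _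
        _ ≤ W.card + 1 + 1 := by
            have := Finset.card_insert_le 3 W
            omega
        _ = W.card + 2 := by ring
  exact absurd hesc (not_lt.mpr hcell)

/-- Contrapositive, the usable form: **if there are only finitely many primes `q` with
`q⁵ ∣ 3^(q−1) − 1`, then `ε` cannot be set to `0` on the depth cells** (with `W` that set, already the
cell `K = #W + 2` has no `ε`-free constant; `K = 2` if `W = ∅`). [folklore] -/
theorem depthCountedABC_not_epsZero_of_wieferich_finite
    (hW : {q : ℕ | q.Prime ∧ q ^ 5 ∣ 3 ^ (q - 1) - 1}.Finite) :
    ¬ ∀ K : ℕ, ∃ C : ℝ, ∀ a b c : ℕ, IsABCTriple a b c →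
      ((a * b * c).primeFactors.filter (fun p => 5 ≤ (a * b * c).factorization p)).card ≤ K →
      (c : ℝ) ≤ C * ((rad a b c : ℕ) : ℝ) :=
  fun h => depthCountedABC_epsZero_imp_wieferich_infinite h hW

end Summit.ABC.ABC.Theorems.DepthCountedABC.Negative
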